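import Summits.QuantumFields.YangMills.Theorems.LuscherReductionDressedRitzLiftLeakageDressedSectors
import Summits.QuantumFields.YangMills.Theorems.LuscherReductionDressedRitzVacuumDictionary
import Summits.QuantumFields.YangMills.Theorems.FemtoTransferGapLevelsDecay
import HarnessLib

/-!
# Crux `DressedRitz` (stmt-QuantumFields-20205), line «polyakovlift» r5, stub S-PSCAL `stub_pscaling` (lane W1-A) — support:
# SLOW∕STIFF AND COUPLING BUDGETS FROM ONE QUASIMODE ESTIMATE (fixed lattice, any size `M`)

Support module (stub worker ym-20205-polyakovlift-w1a g0; `--supports stmt-QuantumFields-20205`, helper, no closure claim).  The lane's target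
`PolyakovLift.ShadowBudgetAt k` (tree `…PolyakovLiftPScalingOfBudget.lean`) asks, per shadow vector `w`, for an exact `l2`-orthonormal
eigenfamily `ψ` of `K_β` (levels `λ_j`) with (i) `Σ_j |λ_j − κ|⟨w,ψ_j⟩² + λ₀‖w − Σ_j⟨w,ψ_j⟩ψ_j‖²` small and (ii) per pair
`Σ_j |λ_j − ½(ρ + ρ′)|·|⟨w,ψ_j⟩⟨w′,ψ_j⟩| + (λ₀ + |κ|)‖r‖‖r′‖` small.  This file proves, for EVERY lattice size and coupling, that both
follow from ONE number per vector — the squared residual `‖K_βw − a·w‖²` of `w` as a QUASIMODE at an approximate eigenvalue `a` — by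
Cauchy–Schwarz against an exact eigenfamily dominating below `a`:

* §1 `sum_abs_mul_sq_le`, `sum_abs_mul_abs_mul_le` (weighted Cauchy–Schwarz on `Fin N`);
* §2 `sum_sq_l2_le` (Bessel), `sum_sq_mul_sq_l2_le` (`Σ_j(λ_j − a)²⟨w,ψ_j⟩² ≤ ‖(K_β − a)w‖²`),
  ★ `slowSum_le_of_quasimode` (`Σ_j|λ_j − μ|⟨w,ψ_j⟩² ≤ ‖(K_β−a)w‖·‖w‖ + |a − μ|‖w‖²`, ANY `μ`),
  ★ `remainder_normSq_le_of_quasimode` (`‖w − Σ⟨w,ψ_j⟩ψ_j‖² ≤ ‖(K_β−a)w‖²/(a − Λ)²` when the family dominates at `Λ < a`),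
  ★ `crossSum_le_of_quasimode` (`Σ_j|λ_j − ½(ρ+ρ′)|·|⟨w,ψ_j⟩⟨w′,ψ_j⟩| ≤ ½(‖(K_β−ρ)w‖‖w′‖ + ‖w‖‖(K_β−ρ′)w′‖)`),
  `residual_rayleigh_le` (the Rayleigh quotient minimises the residual), `abs_rayleigh_le_levelValue_zero`;
* §3 dressing: `iterate_residual_comm` (`(K_β − a)K_β^[m]x = K_β^[m](K_β − a)x`), `normSq_iterate_le` (`‖K_β^[m]y‖² ≤ λ₀^{2m}‖y‖²`),
  ★ `normSq_iterate_ge_of_quasimode` (`‖K_β^[m]x‖² ≥ θ^{2m}(‖x‖² − ‖(K_β−a)x‖²/(a−Λ)² − ‖(K_β−a)x‖²/(a−θ)²)`), hence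
  ★★ `dressed_quasimode_of_quasimode`: an UNDRESSED quasimode bound `‖(K_β − a)x‖² ≤ η²‖x‖²` gives the DRESSED one
  `‖(K_β − a)K_β^[m]x‖² ≤ (λ₀/θ)^{2m}·η²/(1 − η²/(a−Λ)² − η²/(a−θ)²)·‖K_β^[m]x‖²`.

The one-site packaging (`ShadowQuasimodeAt k → ShadowBudgetAt k`) is the companion file `…PolyakovLiftShadowQuasimode.lean`.
HONEST FRAMING: fixed-lattice linear algebra on the conditional femto rung R2b1; no semiclassics, no RG; `stub_pscaling` stays OPEN; nothing
here bears on infinite volume, the continuum limit or the Clay gap.  References: T. Kato, J. Phys. Soc. Japan 4 (1949) 334 [cite: Kato1949, §1];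
M. Reed, B. Simon IV (1978) Thm XIII.1 [cite: ReedSimonIV1978, Thm XIII.1].
-/

set_option autoImplicit false

noncomputable section

open MeasureTheory Filter Topology Real Finset
open Literature.MathematicalPhysics.QuantumFieldTheory
open Literature.MathematicalPhysics.QuantumLattice
open scoped BigOperators

namespace Summit.QuantumFields.YangMills.Theorems.FemtoTransferGap.ShadowQM

open Summit.QuantumFields.YangMills.Theorems.FemtoTransferGap
open Summit.QuantumFields.YangMills.Theorems.FemtoTransferGap.LiftLeak
open Summit.QuantumFields.YangMills.Theorems.FemtoTransferGap.VacDict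

/-! ## §1 Weighted Cauchy–Schwarz on `Fin N` -/

section Real

variable {N : ℕ}

/-- `Σ_j |f_j|·g_j² ≤ √(Σ_j f_j² g_j²)·√(Σ_j g_j²)`. [folklore] -/
theorem sum_abs_mul_sq_le (f g : Fin N → ℝ) :
    ∑ j, |f j| * g j ^ 2 ≤ Real.sqrt (∑ j, f j ^ 2 * g j ^ 2) * Real.sqrt (∑ j, g j ^ 2) := by
  have hcs := Finset.sum_mul_sq_le_sq_mul_sq Finset.univ (fun j => |f j| * |g j|) (fun j => |g j|)
  have hl : ∑ j, |f j| * |g j| * |g j| = ∑ j, |f j| * g j ^ 2 :=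
    sum_congr rfl fun j _ => by rw [mul_assoc, ← sq, sq_abs]
  have hr1 : ∑ j, (|f j| * |g j|) ^ 2 = ∑ j, f j ^ 2 * g j ^ 2 :=
    sum_congr rfl fun j _ => by rw [mul_pow, sq_abs, sq_abs]
  have hr2 : ∑ j, |g j| ^ 2 = ∑ j, g j ^ 2 := sum_congr rfl fun j _ => sq_abs _
  rw [hl, hr1, hr2] at hcs
  have h0 : 0 ≤ ∑ j, |f j| * g j ^ 2 := sum_nonneg fun j _ => mul_nonneg (abs_nonneg _) (sq_nonneg _)
  have hA : 0 ≤ ∑ j, f j ^ 2 * g j ^ 2 := sum_nonneg fun j _ => mul_nonneg (sq_nonneg _) (sq_nonneg _)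
  rw [← Real.sqrt_mul hA, ← Real.sqrt_sq h0]
  exact Real.sqrt_le_sqrt hcs

/-- `Σ_j |f_j|·|p_j q_j| ≤ √(Σ_j f_j² p_j²)·√(Σ_j q_j²)`. [folklore] -/
theorem sum_abs_mul_abs_mul_le (f p q : Fin N → ℝ) :
    ∑ j, |f j| * |p j * q j| ≤ Real.sqrt (∑ j, f j ^ 2 * p j ^ 2) * Real.sqrt (∑ j, q j ^ 2) := by
  have hcs := Finset.sum_mul_sq_le_sq_mul_sq Finset.univ (fun j => |f j| * |p j|) (fun j => |q j|)
  have hl : ∑ j, |f j| * |p j| * |q j| = ∑ j, |f j| * |p j * q j| :=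
    sum_congr rfl fun j _ => by rw [abs_mul, mul_assoc]
  have hr1 : ∑ j, (|f j| * |p j|) ^ 2 = ∑ j, f j ^ 2 * p j ^ 2 :=
    sum_congr rfl fun j _ => by rw [mul_pow, sq_abs, sq_abs]
  have hr2 : ∑ j, |q j| ^ 2 = ∑ j, q j ^ 2 := sum_congr rfl fun j _ => sq_abs _
  rw [hl, hr1, hr2] at hcs
  have h0 : 0 ≤ ∑ j, |f j| * |p j * q j| := sum_nonneg fun j _ => mul_nonneg (abs_nonneg _) (abs_nonneg _)
  have hA : 0 ≤ ∑ j, f j ^ 2 * p j ^ 2 := sum_nonneg fun j _ => mul_nonneg (sq_nonneg _) (sq_nonneg _)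
  rw [← Real.sqrt_mul hA, ← Real.sqrt_sq h0]
  exact Real.sqrt_le_sqrt hcs

end Real

/-! ## §2 Budgets of one vector ∕ one pair from a quasimode residual -/

section Femto

variable {M : ℕ} [NeZero M]

/-- **Bessel**: `Σ_j ⟨w,ψ_j⟩² ≤ ‖w‖²` against a physical `l2`-orthonormal family. [folklore] -/
theorem sum_sq_l2_le {N : ℕ} {ψ : Fin N → (GaugeConfig 3 M SU2 → ℝ)} (hψ : ∀ j, IsPhys (ψ j))
    (hon : ∀ i l, l2 (ψ i) (ψ l) = if i = l then 1 else 0) {w : GaugeConfig 3 M SU2 → ℝ} (hw : IsPhys w) :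
    ∑ j, l2 w (ψ j) ^ 2 ≤ l2 w w := by
  set e : Fin N → physSubmodule M := fun j => ⟨ψ j, hψ j⟩ with he
  have hon' : ∀ i l, l2Form M (e i) (e l) = if i = l then 1 else 0 := fun i l => by
    simpa only [l2Form_apply, he, Submodule.coe_mk] using hon i l
  have h := norm_split (l2Form M) l2Form_symm e hon' ⟨w, hw⟩
  have h0 := l2Form_self_nonneg (⟨w, hw⟩ - ∑ j, l2Form M ⟨w, hw⟩ (e j) • e j)
  simp only [l2Form_apply, he, Submodule.coe_sub, Submodule.coe_sum, Submodule.coe_smul] at h h0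
  linarith

/-- `Σ_j (λ_j − a)²⟨w,ψ_j⟩² ≤ ‖K_βw − a·w‖²` (the slow part of the exact residual split). [cite: ReedSimonIV1978, Thm XIII.1] -/
theorem sum_sq_mul_sq_l2_le (β : ℝ) {N : ℕ} {ψ : Fin N → (GaugeConfig 3 M SU2 → ℝ)} (hψ : ∀ j, IsPhys (ψ j))
    (hon : ∀ i l, l2 (ψ i) (ψ l) = if i = l then 1 else 0) (ev : Fin N → ℝ)
    (heig : ∀ j, transferApply β (ψ j) = ev j • ψ j) {w : GaugeConfig 3 M SU2 → ℝ} (hw : IsPhys w) (a : ℝ) :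
    ∑ j, (ev j - a) ^ 2 * l2 w (ψ j) ^ 2 ≤ l2 (transferApply β w - a • w) (transferApply β w - a • w) := by
  rw [residual_split_eigenfamily β hψ hon ev heig hw a]
  linarith [l2_self_nonneg (transferApply β (w - ∑ j, l2 w (ψ j) • ψ j) - a • (w - ∑ j, l2 w (ψ j) • ψ j))]

/-- The stiff part of the exact residual split: `‖(K_β − a)r‖² ≤ ‖(K_β − a)w‖²`, `r = w − Σ⟨w,ψ_j⟩ψ_j`. [cite: ReedSimonIV1978, Thm XIII.1] -/
theorem remainder_residual_le_residual (β : ℝ) {N : ℕ} {ψ : Fin N → (GaugeConfig 3 M SU2 → ℝ)} (hψ : ∀ j, IsPhys (ψ j))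
    (hon : ∀ i l, l2 (ψ i) (ψ l) = if i = l then 1 else 0) (ev : Fin N → ℝ)
    (heig : ∀ j, transferApply β (ψ j) = ev j • ψ j) {w : GaugeConfig 3 M SU2 → ℝ} (hw : IsPhys w) (a : ℝ) :
    l2 (transferApply β (w - ∑ j, l2 w (ψ j) • ψ j) - a • (w - ∑ j, l2 w (ψ j) • ψ j))
        (transferApply β (w - ∑ j, l2 w (ψ j) • ψ j) - a • (w - ∑ j, l2 w (ψ j) • ψ j)) ≤
      l2 (transferApply β w - a • w) (transferApply β w - a • w) := by
  rw [residual_split_eigenfamily β hψ hon ev heig hw a]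
  have h0 : 0 ≤ ∑ j, (ev j - a) ^ 2 * l2 w (ψ j) ^ 2 := sum_nonneg fun j _ => mul_nonneg (sq_nonneg _) (sq_nonneg _)
  linarith

/-- ★ **Slow sum from the quasimode residual, any pivot `μ`**:
`Σ_j |λ_j − μ|⟨w,ψ_j⟩² ≤ √‖(K_β − a)w‖²·√‖w‖² + |a − μ|·‖w‖²` (Cauchy–Schwarz + Bessel; no gap, no level information). [cite: Kato1949, §1] -/
theorem slowSum_le_of_quasimode (β : ℝ) {N : ℕ} {ψ : Fin N → (GaugeConfig 3 M SU2 → ℝ)} (hψ : ∀ j, IsPhys (ψ j))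
    (hon : ∀ i l, l2 (ψ i) (ψ l) = if i = l then 1 else 0) (ev : Fin N → ℝ)
    (heig : ∀ j, transferApply β (ψ j) = ev j • ψ j) {w : GaugeConfig 3 M SU2 → ℝ} (hw : IsPhys w) (a μ : ℝ) :
    ∑ j, |ev j - μ| * l2 w (ψ j) ^ 2 ≤
      Real.sqrt (l2 (transferApply β w - a • w) (transferApply β w - a • w)) * Real.sqrt (l2 w w) + |a - μ| * l2 w w := by
  have hbes := sum_sq_l2_le hψ hon hw
  have h1 : ∑ j, |ev j - μ| * l2 w (ψ j) ^ 2 ≤ ∑ j, |ev j - a| * l2 w (ψ j) ^ 2 + |a - μ| * ∑ j, l2 w (ψ j) ^ 2 := by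
    rw [mul_sum, ← sum_add_distrib]
    refine sum_le_sum fun j _ => ?_
    have : |ev j - μ| ≤ |ev j - a| + |a - μ| := abs_sub_le (ev j) a μ
    nlinarith [sq_nonneg (l2 w (ψ j)), abs_nonneg (a - μ), abs_nonneg (ev j - a)]
  have h2 : ∑ j, |ev j - a| * l2 w (ψ j) ^ 2 ≤
      Real.sqrt (∑ j, (ev j - a) ^ 2 * l2 w (ψ j) ^ 2) * Real.sqrt (∑ j, l2 w (ψ j) ^ 2) :=
    sum_abs_mul_sq_le (fun j => ev j - a) (fun j => l2 w (ψ j))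
  have h3 : Real.sqrt (∑ j, (ev j - a) ^ 2 * l2 w (ψ j) ^ 2) ≤
      Real.sqrt (l2 (transferApply β w - a • w) (transferApply β w - a • w)) :=
    Real.sqrt_le_sqrt (sum_sq_mul_sq_l2_le β hψ hon ev heig hw a)
  have h4 : Real.sqrt (∑ j, l2 w (ψ j) ^ 2) ≤ Real.sqrt (l2 w w) := Real.sqrt_le_sqrt hbes
  have h5 := mul_le_mul h3 h4 (Real.sqrt_nonneg _) (Real.sqrt_nonneg _)
  have h6 : |a - μ| * ∑ j, l2 w (ψ j) ^ 2 ≤ |a - μ| * l2 w w := mul_le_mul_of_nonneg_left hbes (abs_nonneg _)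
  linarith

/-- ★ **Remainder from the quasimode residual**: if the family dominates at `Λ` (`⟨φ,K_βφ⟩ ≤ Λ‖φ‖²` for physical `φ ⊥ ψ`) and `Λ < a`, then
`‖w − Σ_j⟨w,ψ_j⟩ψ_j‖² ≤ ‖(K_β − a)w‖²/(a − Λ)²` — the part of `w` below the family is controlled by the residual alone. [cite: Kato1949, §1] -/
theorem remainder_normSq_le_of_quasimode (β : ℝ) {N : ℕ} {ψ : Fin N → (GaugeConfig 3 M SU2 → ℝ)} (hψ : ∀ j, IsPhys (ψ j))
    (hon : ∀ i l, l2 (ψ i) (ψ l) = if i = l then 1 else 0) (ev : Fin N → ℝ)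
    (heig : ∀ j, transferApply β (ψ j) = ev j • ψ j) {Λ a : ℝ} (hΛa : Λ < a)
    (hdom : ∀ φ : GaugeConfig 3 M SU2 → ℝ, IsPhys φ → (∀ j, l2 φ (ψ j) = 0) → l2 φ (transferApply β φ) ≤ Λ * l2 φ φ)
    {w : GaugeConfig 3 M SU2 → ℝ} (hw : IsPhys w) :
    l2 (w - ∑ j, l2 w (ψ j) • ψ j) (w - ∑ j, l2 w (ψ j) • ψ j) ≤
      l2 (transferApply β w - a • w) (transferApply β w - a • w) / (a - Λ) ^ 2 := by
  set r := w - ∑ j, l2 w (ψ j) • ψ j with hr_def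
  set Q := l2 (transferApply β w - a • w) (transferApply β w - a • w) with hQ
  have hr : IsPhys r := show r ∈ physSubmodule M from
    Submodule.sub_mem _ hw (Submodule.sum_mem _ fun j _ => Submodule.smul_mem _ _ (hψ j))
  have hrψ : ∀ j, l2 r (ψ j) = 0 := l2_remainder_eq_zero hψ hon hw
  have hgap : 0 < a - Λ := sub_pos.mpr hΛa
  -- `‖(K−a)r‖² ≤ Q`
  have hres : l2 (transferApply β r - a • r) (transferApply β r - a • r) ≤ Q := remainder_residual_le_residual β hψ hon ev heig hw a
  -- `‖r‖²‖(K−a)r‖² ≥ (a‖r‖² − ⟨r,Kr⟩)² ≥ ((a − Λ)‖r‖²)²`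
  have hvar := variance_eq_norm_mul_residual_sub_sq β hr a
  have hcs : l2 r (transferApply β r) ^ 2 ≤ l2 r r * l2 (transferApply β r) (transferApply β r) :=
    sq_l2_le hr (isPhys_transferApply β hr)
  have hn : 0 ≤ l2 r r := l2_self_nonneg r
  have hdr : l2 r (transferApply β r) ≤ Λ * l2 r r := hdom r hr hrψ
  have hkey : ((a - Λ) * l2 r r) ^ 2 ≤ l2 r r * Q := by
    have h1 : (a * l2 r r - l2 r (transferApply β r)) ^ 2 ≤ l2 r r * l2 (transferApply β r - a • r) (transferApply β r - a • r) := by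
      nlinarith
    have h2 : (a - Λ) * l2 r r ≤ a * l2 r r - l2 r (transferApply β r) := by nlinarith
    have h3 : 0 ≤ (a - Λ) * l2 r r := mul_nonneg hgap.le hn
    calc ((a - Λ) * l2 r r) ^ 2 ≤ (a * l2 r r - l2 r (transferApply β r)) ^ 2 := pow_le_pow_left₀ h3 h2 2
      _ ≤ l2 r r * l2 (transferApply β r - a • r) (transferApply β r - a • r) := h1
      _ ≤ l2 r r * Q := mul_le_mul_of_nonneg_left hres hn
  rcases hn.eq_or_lt with h0 | hpos
  · rw [← h0]; exact div_nonneg (l2_self_nonneg _) (sq_nonneg _)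
  · rw [le_div_iff₀ (pow_pos hgap 2)]
    have : l2 r r * (a - Λ) ^ 2 * l2 r r ≤ Q * l2 r r := by nlinarith
    exact le_of_mul_le_mul_right this hpos

/-- ★ **Cross sum of a pair from the two residuals** (midpoint pivot): for any reals `ρ`, `ρ′`,
`Σ_j |λ_j − ½(ρ+ρ′)|·|⟨w,ψ_j⟩⟨w′,ψ_j⟩| ≤ ½(√‖(K_β−ρ)w‖²·√‖w′‖² + √‖w‖²·√‖(K_β−ρ′)w′‖²)`. [cite: Kato1949, §1] -/
theorem crossSum_le_of_quasimode (β : ℝ) {N : ℕ} {ψ : Fin N → (GaugeConfig 3 M SU2 → ℝ)} (hψ : ∀ j, IsPhys (ψ j))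
    (hon : ∀ i l, l2 (ψ i) (ψ l) = if i = l then 1 else 0) (ev : Fin N → ℝ)
    (heig : ∀ j, transferApply β (ψ j) = ev j • ψ j) {w w' : GaugeConfig 3 M SU2 → ℝ} (hw : IsPhys w) (hw' : IsPhys w')
    (ρ ρ' : ℝ) :
    ∑ j, |ev j - (ρ + ρ') / 2| * |l2 w (ψ j) * l2 w' (ψ j)| ≤
      (Real.sqrt (l2 (transferApply β w - ρ • w) (transferApply β w - ρ • w)) * Real.sqrt (l2 w' w') +
        Real.sqrt (l2 w w) * Real.sqrt (l2 (transferApply β w' - ρ' • w') (transferApply β w' - ρ' • w'))) / 2 := by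
  have h1 : ∑ j, |ev j - (ρ + ρ') / 2| * |l2 w (ψ j) * l2 w' (ψ j)| ≤
      (∑ j, |ev j - ρ| * |l2 w (ψ j) * l2 w' (ψ j)| + ∑ j, |ev j - ρ'| * |l2 w' (ψ j) * l2 w (ψ j)|) / 2 := by
    rw [le_div_iff₀ (two_pos), sum_mul, ← sum_add_distrib]
    refine sum_le_sum fun j _ => ?_
    have hm : |l2 w' (ψ j) * l2 w (ψ j)| = |l2 w (ψ j) * l2 w' (ψ j)| := by rw [mul_comm]
    rw [hm]
    have : |ev j - (ρ + ρ') / 2| * 2 ≤ |ev j - ρ| + |ev j - ρ'| := by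
      have e : (ev j - (ρ + ρ') / 2) * 2 = (ev j - ρ) + (ev j - ρ') := by ring
      calc |ev j - (ρ + ρ') / 2| * 2 = |(ev j - (ρ + ρ') / 2) * 2| := by
              rw [abs_mul, abs_of_pos (two_pos : (0 : ℝ) < 2)]
        _ = |(ev j - ρ) + (ev j - ρ')| := by rw [e]
        _ ≤ |ev j - ρ| + |ev j - ρ'| := abs_add_le _ _
    nlinarith [abs_nonneg (l2 w (ψ j) * l2 w' (ψ j)), abs_nonneg (ev j - ρ), abs_nonneg (ev j - ρ')]
  have hA : ∑ j, |ev j - ρ| * |l2 w (ψ j) * l2 w' (ψ j)| ≤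
      Real.sqrt (∑ j, (ev j - ρ) ^ 2 * l2 w (ψ j) ^ 2) * Real.sqrt (∑ j, l2 w' (ψ j) ^ 2) :=
    sum_abs_mul_abs_mul_le (fun j => ev j - ρ) (fun j => l2 w (ψ j)) (fun j => l2 w' (ψ j))
  have hB : ∑ j, |ev j - ρ'| * |l2 w' (ψ j) * l2 w (ψ j)| ≤
      Real.sqrt (∑ j, (ev j - ρ') ^ 2 * l2 w' (ψ j) ^ 2) * Real.sqrt (∑ j, l2 w (ψ j) ^ 2) :=
    sum_abs_mul_abs_mul_le (fun j => ev j - ρ') (fun j => l2 w' (ψ j)) (fun j => l2 w (ψ j))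
  have hA' : Real.sqrt (∑ j, (ev j - ρ) ^ 2 * l2 w (ψ j) ^ 2) * Real.sqrt (∑ j, l2 w' (ψ j) ^ 2) ≤
      Real.sqrt (l2 (transferApply β w - ρ • w) (transferApply β w - ρ • w)) * Real.sqrt (l2 w' w') :=
    mul_le_mul (Real.sqrt_le_sqrt (sum_sq_mul_sq_l2_le β hψ hon ev heig hw ρ)) (Real.sqrt_le_sqrt (sum_sq_l2_le hψ hon hw'))
      (Real.sqrt_nonneg _) (Real.sqrt_nonneg _)
  have hB' : Real.sqrt (∑ j, (ev j - ρ') ^ 2 * l2 w' (ψ j) ^ 2) * Real.sqrt (∑ j, l2 w (ψ j) ^ 2) ≤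
      Real.sqrt (l2 (transferApply β w' - ρ' • w') (transferApply β w' - ρ' • w')) * Real.sqrt (l2 w w) :=
    mul_le_mul (Real.sqrt_le_sqrt (sum_sq_mul_sq_l2_le β hψ hon ev heig hw' ρ')) (Real.sqrt_le_sqrt (sum_sq_l2_le hψ hon hw))
      (Real.sqrt_nonneg _) (Real.sqrt_nonneg _)
  have hcomm : Real.sqrt (l2 (transferApply β w' - ρ' • w') (transferApply β w' - ρ' • w')) * Real.sqrt (l2 w w) =
      Real.sqrt (l2 w w) * Real.sqrt (l2 (transferApply β w' - ρ' • w') (transferApply β w' - ρ' • w')) := mul_comm _ _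
  linarith

/-- **The Rayleigh quotient minimises the residual**: `‖(K_β − ρ)w‖² ≤ ‖(K_β − a)w‖²` for `ρ = ⟨w,K_βw⟩/‖w‖²`, `‖w‖² > 0`, every `a`. [cite: Kato1949, §1] -/
theorem residual_rayleigh_le (β : ℝ) {w : GaugeConfig 3 M SU2 → ℝ} (hw : IsPhys w) (hn : 0 < l2 w w) (a : ℝ) :
    l2 (transferApply β w - (l2 w (transferApply β w) / l2 w w) • w) (transferApply β w - (l2 w (transferApply β w) / l2 w w) • w) ≤
      l2 (transferApply β w - a • w) (transferApply β w - a • w) := by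
  have hvar := variance_le_norm_mul_residual β hw a
  set ϱ := l2 (transferApply β w - a • w) (transferApply β w - a • w) / l2 w w with hϱ
  have h : l2 (transferApply β w) (transferApply β w) * l2 w w - l2 w (transferApply β w) ^ 2 ≤ ϱ * l2 w w ^ 2 := by
    rw [hϱ, div_mul_eq_mul_div, le_div_iff₀ hn]; nlinarith
  have h2 := residual_le_of_leakage β hw hn h
  rwa [hϱ, div_mul_cancel₀ _ hn.ne'] at h2

/-- `|⟨w,K_βw⟩/‖w‖²| ≤ λ₀` (`β ≥ 0`; junk-safe at `‖w‖² = 0`). [folklore] -/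
theorem abs_rayleigh_le_levelValue_zero {β : ℝ} (hβ : 0 ≤ β) {w : GaugeConfig 3 M SU2 → ℝ} (hw : IsPhys w) :
    |l2 w (transferApply β w) / l2 w w| ≤ levelValue su2Rep M β 0 := by
  have hq0 : 0 ≤ l2 w (transferApply β w) := by rw [← qform_eq_l2_transferApply]; exact qform_su2Rep_self_nonneg hβ hw
  have hq1 : l2 w (transferApply β w) ≤ levelValue su2Rep M β 0 * l2 w w := by
    rw [← qform_eq_l2_transferApply]; exact qform_self_le_levelValue_zero_mul β hw
  have hl0 : 0 ≤ levelValue su2Rep M β 0 := (levelValue_zero_su2Rep_pos M β).le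
  rcases (l2_self_nonneg w).eq_or_lt with h0 | hpos
  · rw [← h0, div_zero, abs_zero]; exact hl0
  · rw [abs_of_nonneg (div_nonneg hq0 hpos.le), div_le_iff₀ hpos]; exact hq1

/-! ## §3 Dressing: the undressed quasimode bound controls the dressed vector -/

/-- `(K_β − a)·K_β^[m] x = K_β^[m]·(K_β − a) x` for physical `x`. [folklore] -/
theorem iterate_residual_comm (β : ℝ) {x : GaugeConfig 3 M SU2 → ℝ} (hx : IsPhys x) (a : ℝ) (m : ℕ) :
    transferApply β ((transferApply β)^[m] x) - a • (transferApply β)^[m] x =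
      (transferApply β)^[m] (transferApply β x - a • x) := by
  have h := iterate_map_sub (transferOp (L := M) β) (transferOp β ⟨x, hx⟩) (a • ⟨x, hx⟩) m
  have hs : (⇑(transferOp (L := M) β))^[m] (a • (⟨x, hx⟩ : physSubmodule M)) = a • (⇑(transferOp β))^[m] ⟨x, hx⟩ :=
    VacDict.iterate_smul β m a ⟨x, hx⟩
  rw [hs, ← Function.iterate_succ_apply, Function.iterate_succ_apply'] at h
  have h' := congrArg (fun y : physSubmodule M => (y : GaugeConfig 3 M SU2 → ℝ)) h
  simp only [Submodule.coe_sub, Submodule.coe_smul, coe_transferOp, VacDict.coe_iterate_transferOp] at h'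
  exact h'.symm

/-- `‖K_β^[m] y‖² ≤ λ₀^{2m}‖y‖²` for physical `y` (`β ≥ 0`; domination of the EMPTY family at `λ₀`). [folklore] -/
theorem normSq_iterate_le {β : ℝ} (hβ : 0 ≤ β) {y : GaugeConfig 3 M SU2 → ℝ} (hy : IsPhys y) (m : ℕ) :
    l2 ((transferApply β)^[m] y) ((transferApply β)^[m] y) ≤ levelValue su2Rep M β 0 ^ (2 * m) * l2 y y := by
  have hdom : ∀ φ : GaugeConfig 3 M SU2 → ℝ, IsPhys φ → (∀ j : Fin 0, l2 φ (Fin.elim0 j) = 0) →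
      l2 φ (transferApply β φ) ≤ levelValue su2Rep M β 0 * l2 φ φ := fun φ hφ _ => by
    rw [← qform_eq_l2_transferApply]; exact qform_self_le_levelValue_zero_mul β hφ
  exact (iterate_remainder_bounds (ψ := fun j : Fin 0 => Fin.elim0 j) hβ (fun j => Fin.elim0 j) (fun j => Fin.elim0 j)
    (fun j => Fin.elim0 j) (levelValue_zero_su2Rep_pos M β).le hdom hy (fun j => Fin.elim0 j) 0 m).1

/-- The DRESSED residual is at most `λ₀^{2m}` times the undressed one: `‖(K_β − a)K_β^[m]x‖² ≤ λ₀^{2m}‖(K_β − a)x‖²`. [folklore] -/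
theorem residual_iterate_le {β : ℝ} (hβ : 0 ≤ β) {x : GaugeConfig 3 M SU2 → ℝ} (hx : IsPhys x) (a : ℝ) (m : ℕ) :
    l2 (transferApply β ((transferApply β)^[m] x) - a • (transferApply β)^[m] x)
        (transferApply β ((transferApply β)^[m] x) - a • (transferApply β)^[m] x) ≤
      levelValue su2Rep M β 0 ^ (2 * m) * l2 (transferApply β x - a • x) (transferApply β x - a • x) := by
  rw [iterate_residual_comm β hx a m]
  have hy : IsPhys (transferApply β x - a • x) := show transferApply β x - a • x ∈ physSubmodule M from
    Submodule.sub_mem _ (isPhys_transferApply β hx) (Submodule.smul_mem _ _ hx)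
  exact normSq_iterate_le hβ hy m

/-- ★ **Mass of the dressed vector from the undressed quasimode bound.**  `ψ` an exact physical `l2`-orthonormal eigenfamily (levels `λ_j`)
dominating at `Λ`; `x` physical; `0 ≤ θ < a`, `Λ < a`; `Q = ‖(K_β − a)x‖²`.  Then
`‖K_β^[m]x‖² ≥ θ^{2m}·(‖x‖² − Q/(a−Λ)² − Q/(a−θ)²)`: the levels `≥ θ` keep the factor `θ^{2m}`, the mass below `θ` inside the family is
`≤ Q/(a−θ)²`, the remainder is `≤ Q/(a−Λ)²`. [cite: Kato1949, §1] [cite: ReedSimonIV1978, Thm XIII.1] -/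
theorem normSq_iterate_ge_of_quasimode {β : ℝ} {N : ℕ} {ψ : Fin N → (GaugeConfig 3 M SU2 → ℝ)}
    (hψ : ∀ j, IsPhys (ψ j)) (hon : ∀ i l, l2 (ψ i) (ψ l) = if i = l then 1 else 0) (ev : Fin N → ℝ)
    (heig : ∀ j, transferApply β (ψ j) = ev j • ψ j) {Λ a θ : ℝ} (hΛa : Λ < a) (hθ : 0 ≤ θ) (hθa : θ < a)
    (hdom : ∀ φ : GaugeConfig 3 M SU2 → ℝ, IsPhys φ → (∀ j, l2 φ (ψ j) = 0) → l2 φ (transferApply β φ) ≤ Λ * l2 φ φ)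
    {x : GaugeConfig 3 M SU2 → ℝ} (hx : IsPhys x) (m : ℕ) :
    θ ^ (2 * m) * (l2 x x - l2 (transferApply β x - a • x) (transferApply β x - a • x) / (a - Λ) ^ 2 -
        l2 (transferApply β x - a • x) (transferApply β x - a • x) / (a - θ) ^ 2) ≤
      l2 ((transferApply β)^[m] x) ((transferApply β)^[m] x) := by
  classical
  set Q := l2 (transferApply β x - a • x) (transferApply β x - a • x) with hQ
  set c : Fin N → ℝ := fun j => l2 x (ψ j) with hc
  set r := x - ∑ j, l2 x (ψ j) • ψ j with hr_def
  have hθm : 0 ≤ θ ^ (2 * m) := pow_nonneg hθ _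
  -- norm split of `x` and of the dressed vector
  have hsplit0 : l2 x x = ∑ j, c j ^ 2 + l2 r r := by
    have h := normSq_iterate_split_eigenfamily β hψ hon ev heig hx 0
    simpa only [Function.iterate_zero, id_eq, mul_zero, pow_zero, one_mul] using h
  have hsplitm := normSq_iterate_split_eigenfamily β hψ hon ev heig hx m
  have hremm : 0 ≤ l2 ((transferApply β)^[m] r) ((transferApply β)^[m] r) := l2_self_nonneg _
  -- mass below `θ` inside the family
  have hgapθ : 0 < a - θ := sub_pos.mpr hθa
  have hlow : ∑ j ∈ univ.filter (fun j => ev j < θ), c j ^ 2 ≤ Q / (a - θ) ^ 2 := by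
    rw [le_div_iff₀ (pow_pos hgapθ 2), sum_mul]
    calc ∑ j ∈ univ.filter (fun j => ev j < θ), c j ^ 2 * (a - θ) ^ 2
        ≤ ∑ j ∈ univ.filter (fun j => ev j < θ), (ev j - a) ^ 2 * c j ^ 2 := by
          refine sum_le_sum fun j hj => ?_
          have hj' : ev j < θ := (mem_filter.mp hj).2
          have h1 : (a - θ) ^ 2 ≤ (ev j - a) ^ 2 := by
            have : (ev j - a) ^ 2 = (a - ev j) ^ 2 := by ring
            rw [this]; exact pow_le_pow_left₀ hgapθ.le (by linarith) 2
          nlinarith [sq_nonneg (c j)]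
      _ ≤ ∑ j, (ev j - a) ^ 2 * c j ^ 2 :=
          sum_le_sum_of_subset_of_nonneg (filter_subset _ _) fun j _ _ => mul_nonneg (sq_nonneg _) (sq_nonneg _)
      _ ≤ Q := sum_sq_mul_sq_l2_le β hψ hon ev heig hx a
  -- remainder mass
  have hrem : l2 r r ≤ Q / (a - Λ) ^ 2 := remainder_normSq_le_of_quasimode β hψ hon ev heig hΛa hdom hx
  -- levels `≥ θ` keep `θ^{2m}`
  have hhigh : θ ^ (2 * m) * ∑ j ∈ univ.filter (fun j => ¬ ev j < θ), c j ^ 2 ≤ ∑ j, ev j ^ (2 * m) * c j ^ 2 := by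
    rw [mul_sum]
    calc ∑ j ∈ univ.filter (fun j => ¬ ev j < θ), θ ^ (2 * m) * c j ^ 2
        ≤ ∑ j ∈ univ.filter (fun j => ¬ ev j < θ), ev j ^ (2 * m) * c j ^ 2 := by
          refine sum_le_sum fun j hj => ?_
          have hj' : θ ≤ ev j := not_lt.mp (mem_filter.mp hj).2
          exact mul_le_mul_of_nonneg_right (pow_le_pow_left₀ hθ hj' _) (sq_nonneg _)
      _ ≤ ∑ j, ev j ^ (2 * m) * c j ^ 2 :=
          sum_le_sum_of_subset_of_nonneg (filter_subset _ _) fun j _ _ =>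
            mul_nonneg (by rw [pow_mul']; exact sq_nonneg _) (sq_nonneg _)
  have hpart : ∑ j, c j ^ 2 = ∑ j ∈ univ.filter (fun j => ev j < θ), c j ^ 2 + ∑ j ∈ univ.filter (fun j => ¬ ev j < θ), c j ^ 2 :=
    (sum_filter_add_sum_filter_not _ _ _).symm
  calc θ ^ (2 * m) * (l2 x x - Q / (a - Λ) ^ 2 - Q / (a - θ) ^ 2)
      ≤ θ ^ (2 * m) * ∑ j ∈ univ.filter (fun j => ¬ ev j < θ), c j ^ 2 := by
        apply mul_le_mul_of_nonneg_left _ hθm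
        rw [hsplit0, hpart]; linarith
    _ ≤ ∑ j, ev j ^ (2 * m) * c j ^ 2 := hhigh
    _ ≤ l2 ((transferApply β)^[m] x) ((transferApply β)^[m] x) := by rw [hsplitm]; linarith

/-- ★★ **Dressed quasimode from undressed quasimode.**  Under the hypotheses of `normSq_iterate_ge_of_quasimode`, if
`‖(K_β − a)x‖² ≤ η²·‖x‖²` with `δ := 1 − η²/(a−Λ)² − η²/(a−θ)² > 0`, then the dressed vector `w = K_β^[m]x` obeys
`θ^{2m}·δ·‖(K_β − a)w‖² ≤ λ₀^{2m}·η²·‖w‖²`. [cite: Kato1949, §1] [cite: ReedSimonIV1978, Thm XIII.1] -/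
theorem dressed_quasimode_of_quasimode {β : ℝ} (hβ : 0 ≤ β) {N : ℕ} {ψ : Fin N → (GaugeConfig 3 M SU2 → ℝ)}
    (hψ : ∀ j, IsPhys (ψ j)) (hon : ∀ i l, l2 (ψ i) (ψ l) = if i = l then 1 else 0) (ev : Fin N → ℝ)
    (heig : ∀ j, transferApply β (ψ j) = ev j • ψ j) {Λ a θ η2 : ℝ} (hΛa : Λ < a) (hθ : 0 ≤ θ) (hθa : θ < a) (hη2 : 0 ≤ η2)
    (hdom : ∀ φ : GaugeConfig 3 M SU2 → ℝ, IsPhys φ → (∀ j, l2 φ (ψ j) = 0) → l2 φ (transferApply β φ) ≤ Λ * l2 φ φ)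
    {x : GaugeConfig 3 M SU2 → ℝ} (hx : IsPhys x) (m : ℕ)
    (hq : l2 (transferApply β x - a • x) (transferApply β x - a • x) ≤ η2 * l2 x x) :
    θ ^ (2 * m) * (1 - η2 / (a - Λ) ^ 2 - η2 / (a - θ) ^ 2) *
        l2 (transferApply β ((transferApply β)^[m] x) - a • (transferApply β)^[m] x)
          (transferApply β ((transferApply β)^[m] x) - a • (transferApply β)^[m] x) ≤
      levelValue su2Rep M β 0 ^ (2 * m) * η2 * l2 ((transferApply β)^[m] x) ((transferApply β)^[m] x) := by
  set Q := l2 (transferApply β x - a • x) (transferApply β x - a • x) with hQ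
  set W := l2 ((transferApply β)^[m] x) ((transferApply β)^[m] x) with hW
  set R := l2 (transferApply β ((transferApply β)^[m] x) - a • (transferApply β)^[m] x)
    (transferApply β ((transferApply β)^[m] x) - a • (transferApply β)^[m] x) with hR
  have hmass := normSq_iterate_ge_of_quasimode hψ hon ev heig hΛa hθ hθa hdom hx m
  have hres : R ≤ levelValue su2Rep M β 0 ^ (2 * m) * Q := residual_iterate_le hβ hx a m
  have hθm : 0 ≤ θ ^ (2 * m) := pow_nonneg hθ _
  have hl0 : 0 ≤ levelValue su2Rep M β 0 ^ (2 * m) := pow_nonneg (levelValue_zero_su2Rep_pos M β).le _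
  have hR0 : 0 ≤ R := l2_self_nonneg _
  have hQ0 : 0 ≤ Q := l2_self_nonneg _
  have hxx : 0 ≤ l2 x x := l2_self_nonneg _
  have hgΛ : 0 < (a - Λ) ^ 2 := pow_pos (sub_pos.mpr hΛa) 2
  have hgθ : 0 < (a - θ) ^ 2 := pow_pos (sub_pos.mpr hθa) 2
  -- `θ^{2m}(1 − η²/(a−Λ)² − η²/(a−θ)²)‖x‖² ≤ W`
  have hmass' : θ ^ (2 * m) * (1 - η2 / (a - Λ) ^ 2 - η2 / (a - θ) ^ 2) * l2 x x ≤ W := by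
    have h1 : Q / (a - Λ) ^ 2 ≤ η2 / (a - Λ) ^ 2 * l2 x x := by
      rw [div_mul_eq_mul_div]; exact div_le_div_of_nonneg_right hq hgΛ.le
    have h2 : Q / (a - θ) ^ 2 ≤ η2 / (a - θ) ^ 2 * l2 x x := by
      rw [div_mul_eq_mul_div]; exact div_le_div_of_nonneg_right hq hgθ.le
    calc θ ^ (2 * m) * (1 - η2 / (a - Λ) ^ 2 - η2 / (a - θ) ^ 2) * l2 x x
        = θ ^ (2 * m) * (l2 x x - η2 / (a - Λ) ^ 2 * l2 x x - η2 / (a - θ) ^ 2 * l2 x x) := by ring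
      _ ≤ θ ^ (2 * m) * (l2 x x - Q / (a - Λ) ^ 2 - Q / (a - θ) ^ 2) := by
          apply mul_le_mul_of_nonneg_left _ hθm; linarith
      _ ≤ W := hmass
  -- combine
  by_cases hδ : 0 ≤ 1 - η2 / (a - Λ) ^ 2 - η2 / (a - θ) ^ 2
  · calc θ ^ (2 * m) * (1 - η2 / (a - Λ) ^ 2 - η2 / (a - θ) ^ 2) * R
        ≤ θ ^ (2 * m) * (1 - η2 / (a - Λ) ^ 2 - η2 / (a - θ) ^ 2) * (levelValue su2Rep M β 0 ^ (2 * m) * Q) :=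
          mul_le_mul_of_nonneg_left hres (mul_nonneg hθm hδ)
      _ ≤ θ ^ (2 * m) * (1 - η2 / (a - Λ) ^ 2 - η2 / (a - θ) ^ 2) * (levelValue su2Rep M β 0 ^ (2 * m) * (η2 * l2 x x)) :=
          mul_le_mul_of_nonneg_left (mul_le_mul_of_nonneg_left hq hl0) (mul_nonneg hθm hδ)
      _ = levelValue su2Rep M β 0 ^ (2 * m) * η2 * (θ ^ (2 * m) * (1 - η2 / (a - Λ) ^ 2 - η2 / (a - θ) ^ 2) * l2 x x) := by ring
      _ ≤ levelValue su2Rep M β 0 ^ (2 * m) * η2 * W := mul_le_mul_of_nonneg_left hmass' (mul_nonneg hl0 hη2)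
  · push Not at hδ
    have h1 : θ ^ (2 * m) * (1 - η2 / (a - Λ) ^ 2 - η2 / (a - θ) ^ 2) * R ≤ 0 :=
      mul_nonpos_of_nonpos_of_nonneg (mul_nonpos_of_nonneg_of_nonpos hθm hδ.le) hR0
    exact h1.trans (mul_nonneg (mul_nonneg hl0 hη2) (l2_self_nonneg _))

end Femto

end Summit.QuantumFields.YangMills.Theorems.FemtoTransferGap.ShadowQM

end
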